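import Summits.ResolutionOfSingularities.ResolutionOfSingularities.Theses.TropicalLinks
import Literature.AlgebraicGeometry.Tropical.InitialIdeal
import Literature.AlgebraicGeometry.Tropical.SchonIdeal
import Summits.ResolutionOfSingularities.ResolutionOfSingularities.Theorems.InductiveStep.Negative.AboveGraphLegKernel
import Summits.ResolutionOfSingularities.ResolutionOfSingularities.Theorems.InductiveStep.Negative.TorusLegDegeneration
import Summits.ResolutionOfSingularities.ResolutionOfSingularities.Theorems.InductiveStep.Negative.TorusLegNode

/-! # Disproof of `InductiveStep` — findings (crux-attack seed, refuter-rattack-stmt-ResolutionOfSingularities-17233-0, 2026-08-17)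

Crux `TropicalLinks.InductiveStep` (stmt-ResolutionOfSingularities-17233):
`∀ p prime, ∀ d, (∀ d' < d, SchonAt p d') → SchonAt p d`, where `SchonAt p d` = every `d`-dimensional
PRIME ideal `I ⊆ k[x₁^±..x_N^±]` (`k = k̄`, `char k = p`) admits Laurent polynomials `G₁..G_m ∉ I` such
that the re-embedded principal open `U[G⁻¹] ⊆ 𝔾_m^(N+m)` (ideal `I' = ⟨ι I, y_j − ι G_j⟩`) has EVERY
initial degeneration `k[ℤ^(N+m)] ⧸ in_w(I')` regular (`w ∈ ℤ^(N+m)`, min-convention initial ideal =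
span of the initial forms of all elements of `I'`).

NO KILL.  Findings of the basic attacks (all Lean-checked in this file unless marked "paper"):

* (F1) COSTUME w.r.t. the TARGET: `InductiveStep ↔ SchonPlus` (`inductiveStep_iff_schonPlus`, axioms
  propext/Classical.choice/Quot.sound).  The induction hypothesis is logically inert (strong induction /
  weakening): the crux IS the rank-0 target = Tevelev's schön-open conjecture in characteristic `p`
  (Amer. J. Math. 129 (2007), Rem. 3.3), in the principal-open Gröbner form.  It also gives the support
  rung `SchonLowDim` outright (`schonLowDim_of_inductiveStep`).
* (F2) RESTATES-THE-SUMMIT probes `C → S`, `S → C` (`exact?` / `aesop`, maxHeartbeats 400000): FAIL 4/4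
  (folder `Probes.lean`).  On paper: `C ⟹ S` needs crux `SchonResolves` (Tevelev 2007 Thm 1.4 + toric
  resolution of fans + Luxton–Qu Thm 1.5, char-free printed mathematics, unformalised) and the two
  Descent cruxes; `S ⟹ C` is NOT known even on paper — `SchonAt p d` needs a regular projective closure
  of a `d`-fold AND an snc (embedded) resolution of its boundary divisor (Luxton–Qu §3, p. 7–8 of
  arXiv:0902.2009, read), i.e. log-resolution input; known in substance for `d ≤ 3`
  (CossartPiltant2019 + CJS2009/Cutkosky2009), open and ≥ resolution-of-4-folds strength for `d ≥ 4`.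
* (F3) NOT VACUOUS: the hypotheses of `SchonAt p d` are satisfiable — `AlgebraicClosure (ZMod p)` is an
  algebraically closed field of characteristic `p` (instances found), and for every `N` the
  augmentation ideal `ker(x^v ↦ 1)` of `k[ℤ^N]` is PRIME with quotient of Krull dimension `0`
  (`ker_aug_isPrime`, `ringKrullDim_quot_ker_aug`); `⊥` is prime (`k[ℤ^N]` is a domain: the torus, `d = N`).
* (F4) NOT TRIVIALLY TRUE / FALSE: `exact?`, `aesop`, `simp [InductiveStep]` fail on `InductiveStep` and on
  `¬ InductiveStep` (6/6, `Probes.lean`).  Paper: no trivial witness — `I` prime and `G_j ∉ I` force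
  `k[ℤ^(N+m)] ⧸ I' ≅ (k[ℤ^N] ⧸ I)[G⁻¹] ≠ 0`, and at `w = 0` one has `in_0(I') = I'`
  (`Literature…Tropical.weightInitialIdeal_zero`), so the conclusion demands that the principal open
  `U[G⁻¹]` itself be REGULAR — a genuine condition; off `Trop` the initial ideal is `⊤` and the condition is
  vacuous, as intended.  `I.IsPrime` is load-bearing against the junk witness: for a NON-reduced `I` a
  nilpotent `G ∉ I` gives `I' = ⊤` (since `y_j² − ι(G²) ∈ I'`, `y_j²` a unit) and every degeneration empty.
* (F5) DEGENERATE INSTANCES (paper): `d = 0` (points `t ∈ (k^*)^N`, `I = 𝔪_t` maximal): TRUE with `m = 0`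
  (`w ≠ 0 ⇒ in_w(𝔪_t) ∋` a unit; `w = 0 ⇒` quotient `= k`).  `N = 0`: only `I = ⊥`, `d = 0`, same.  `d = 1`:
  plausible by Riemann–Roch units making every puncture's valuation vector primitive and separating
  punctures on a common ray (+ Bertini for simple zeros) — the planner's `SchonLowDim` d ≤ 1 argument
  checks out on paper (e.g. `y = (x−1)²` in `𝔾_m²`: `in_(0,1) = ⟨(x−1)²⟩` non-reduced; adjoining `G = x − 1`
  repairs it: `in_(0,2,1)⟨y − z², z − x + 1⟩ = ⟨x − 1, y − z²⟩`, quotient `k[z^±]`).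
* (F6) QUANTIFIER ORDER / NORMALISATION (paper): `∃ (m, G)` precedes `∀ w ∀ P` — one re-embedding for all
  weights, as "`U[G⁻¹]` is schön" requires; `w` ranges over all of `ℤ^(N+m)` (both signs), so the min/max
  convention is immaterial; regular-at-all-primes = regular-at-maximal-ideals (Serre); the graph embedding
  keeps `x_i`, and since every unit of `U[G⁻¹]` is `g/G^a` with `g ∈ 𝒪(U)` a unit on `U[G⁻¹]`, numerator
  lifts may be adjoined without shrinking, so "schön in the `(x, G)`-torus" ⟺ "schön in the intrinsic
  torus" (Luxton–Qu Lemma 2.13, p. 6 read, + the subtorus-coset reduction).  No missing side condition found.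
* (F7) CHEAPEST FALSIFIER: not finite — `∃ G` over Laurent polynomials over infinite fields, `∀ w ∈ ℤ^(N+m)`;
  a Gröbner-fan experiment (planner's kit spec) can only produce evidence, never `¬∃`.  A refutation needs a
  very affine variety over `𝔽̄_p` with NO schön principal open, i.e. a function field of char `p` without
  a log-smooth toroidal model — none known; not attempted (would be a resolution-level negative).

Used from the standing disprover: nothing (no prior `Disproof.lean` for this crux).  Prior art on the
item: Equiv.lean (route-review refuter, 2026-08-16: the same `↔`), STRATEGY-CENSUS / SPLIT (crux-strategist:
BC2 redirect into RegularProjectiveClosure + SncBoundaryClosure + SncClosureSchon; note its `InductiveStep_of`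
uses neither the induction hypothesis NOR the dimension hypothesis — the stubs are dimension-free, i.e.
all-dimensional Tevelev).
-/

namespace Summit.ResolutionOfSingularities.ResolutionOfSingularities.Cruxes.InductiveStep.Disproof

open Summit.ResolutionOfSingularities.ResolutionOfSingularities.Theses.TropicalLinks

set_option linter.dupNamespace false

/-! ## (F1) Costume: the crux is the target -/

/-- **`InductiveStep ↔ SchonPlus`**: strong induction one way, weakening the other — the induction
hypothesis of the crux is logically inert; the crux is Tevelev's schön-open conjecture in char `p`
(the route's rank-0 target) verbatim. -/
theorem inductiveStep_iff_schonPlus : InductiveStep ↔ SchonPlus := by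
  constructor
  · intro h p hp d
    induction d using Nat.strong_induction_on with
    | _ d ih => exact h p hp d ih
  · intro h p hp d _
    exact h p hp d

/-- The crux gives the support rung `SchonLowDim` (d ≤ 2) outright. -/
theorem schonLowDim_of_inductiveStep (h : InductiveStep) : SchonLowDim :=
  fun p hp d _ => inductiveStep_iff_schonPlus.1 h p hp d

/-- Conversely the target gives the crux (the trivial direction, recorded by name). -/
theorem inductiveStep_of_schonPlus (h : SchonPlus) : InductiveStep :=
  inductiveStep_iff_schonPlus.2 h

/-! ## (F3) Non-vacuity of the hypotheses of `SchonAt p d` -/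

section NonVacuity

example (p : ℕ) [Fact p.Prime] : CharP (AlgebraicClosure (ZMod p)) p := inferInstance
example (p : ℕ) [Fact p.Prime] : IsAlgClosed (AlgebraicClosure (ZMod p)) := inferInstance

variable (k : Type) [Field k] (N : ℕ)

/-- The augmentation `ε : k[ℤ^N] →ₐ[k] k`, every monomial `x^v ↦ 1` (the point `(1,…,1)` of the torus). -/
noncomputable def aug : AddMonoidAlgebra k (Fin N → ℤ) →ₐ[k] k :=
  AddMonoidAlgebra.lift k k (Fin N → ℤ) 1

theorem aug_surjective : Function.Surjective (aug k N) := fun c =>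
  ⟨algebraMap k _ c, (aug k N).commutes c⟩

/-- The augmentation ideal (the point `1 ∈ 𝔾_m^N`) is a PRIME ideal of the Laurent polynomial ring … -/
theorem ker_aug_isPrime : (RingHom.ker (aug k N).toRingHom).IsPrime :=
  (RingHom.ker_isMaximal_of_surjective _ (aug_surjective k N)).isPrime

/-- … of Krull dimension `0`: the `d = 0` instance of `SchonAt` quantifies over a nonempty family
(for every `p`, `k`, `N`). -/
theorem ringKrullDim_quot_ker_aug :
    ringKrullDim (AddMonoidAlgebra k (Fin N → ℤ) ⧸ RingHom.ker (aug k N).toRingHom) =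
      ((0 : ℕ) : WithBot ℕ∞) := by
  rw [ringKrullDim_eq_of_ringEquiv (RingHom.quotientKerEquivOfSurjective (aug_surjective k N)),
    ringKrullDim_eq_zero_of_field]
  rfl

/-- `k[ℤ^N]` is a domain: `⊥` (the torus itself, `d = N`) is prime as well. -/
theorem bot_isPrime : (⊥ : Ideal (AddMonoidAlgebra k (Fin N → ℤ))).IsPrime := Ideal.isPrime_bot

end NonVacuity

/-! ## (F2)/(F4) Probes (folder `Probes.lean`, all FAIL as expected; maxHeartbeats 400000)
  P1 `InductiveStep → ResolutionOfSingularities` by `exact?` — could not close the goal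
  P2 same by `aesop` — made no progress
  P3 `ResolutionOfSingularities → InductiveStep` by `exact?` — could not close the goal
  P4 same by `aesop` — made no progress
  P5–P7 `InductiveStep` by `exact?` / `aesop` / `simp [InductiveStep]` — fail (unsolved goals)
  P8–P10 `¬ InductiveStep` by `exact?` / `aesop` / `simp [InductiveStep]` — fail (aesop: exhaustive search failed) -/

/-! # cdisprove cycle 1 (refuter-cdisprove-stmt-ResolutionOfSingularities-17233-0, 2026-08-17) — EXTENSION

Read at start: this file (F1–F7 above, by the refuter-first seat), `SPLIT.md`, `STRATEGY-CENSUS.md`,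
`Lines/split.lean` (the REGISTERED skeleton: stubs `stub_regularProjectiveClosure`,
`stub_sncBoundaryClosure`, `stub_sncClosureSchon`, composition `InductiveStep_of` proved), the item's
notes/evidence, Luxton–Qu arXiv:0902.2009 §3 (pp. 7–8, materialised and read), the definition files
`Literature/AlgebraicGeometry/Tropical/{InitialIdeal, SchonIdeal, TropicalLink}`.

STILL NO KILL — and none is available short of a counterexample to Tevelev's schön-open conjecture in
characteristic `p` (F1: the crux IS the target).  New, kernel-checked content of this cycle:

* (F8) JUNK GUARDS (landed as `Theorems/InductiveStep/Negative/InductiveStepWithoutIsPrimeIff.lean`):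
  the guard `∀ j, G j ∉ I` is the ONLY anti-vacuity device of the typing — delete it and the conclusion of
  `SchonAt` holds for every ideal (`G = 0 ⇒ I' = ⊤ ⇒` every `in_w(I') = ⊤ ⇒` no primes); `I.IsPrime` is NOT
  load-bearing for the truth value: `InductiveStep ↔ InductiveStep-with-IsPrime-deleted` (a non-prime `I`
  of dimension `d` is junk-true through a zero-divisor pair `G = (a, b)`, `ab ∈ I`, which passes the guard
  and still gives `y₀y₁ ∈ I'`; `I = ⊤` is excluded by `ringKrullDim (k[ℤ^N] ⧸ ⊤) = ⊥ ≠ d`).  Consequence for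
  attackers: no disproof from reducible / non-reduced `V(I)`; for provers: primality is free.
* (F9) SHAPE OF A COUNTEREXAMPLE + NAMED RESTATEMENT (landed as `…/Negative/NotInductiveStepIff.lean`):
  `¬ InductiveStep ↔ ¬ SchonPlus ↔ ∃ p prime ∃ d, ¬ SchonAt p d ↔ ∃ p prime ∃ d minimal …`; and
  `InductiveStep ↔` the same statement with the inlined schön clause replaced by the tree's
  `Literature.AlgebraicGeometry.Tropical.IsSchonIdeal ⟨ι I, y_j − ι G_j⟩` (bridge
  `inductiveStep_weightInitialIdeal_eq_span`, see F10 for why it is not `rfl`).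
* (F10) TWO ELABORATION TRAPS (found while landing F8/F9; they will bite every prover of 17232–17235 and of
  the split children):
  (T1) the route file elaborates under `open scoped Classical`, and — by elaboration order, the binder `v`
  of `f.coeff.filter (fun v => …)` being untyped when the `DecidablePred` instance is synthesised — the
  instance recorded IN THE ROUTE TERM is `Classical.propDecidable`, whereas the definition file
  `Tropical/InitialIdeal` (no `Classical`) records the constructive `Finset` instance: so
  `weightInitialIdeal_eq_span : weightInitialIdeal w I = <inlined term>` is `rfl` inside that file but does
  NOT fire against the route's decls (`rfl` fails: folder `T6.lean`), and a fragment of `SchonAt` elaborated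
  without `open scoped Classical` is propositionally but not definitionally equal to the route's — `exact`
  / unification against `InductiveStep` then dies by `whnf` time-out (folder `T3.lean` vs `T5.lean`).
  REMEDY: `open scoped Classical` in every file citing these decls, and state generic bridge lemmas with
  the instance as an explicit argument `dec` (as done in F8/F9; `congr!` closes the instance by
  subsingleton elimination).
  (T2) restating the schön clause for a VARIABLE ideal `J` (`∀ w (P : Ideal (k[ℤ^M] ⧸ Ideal.span (in_w '' ↑J)))
  [P.IsPrime], IsRegularLocalRing (Localization.AtPrime P)`) with the untyped binder `fun v => …` makes
  `CommRing (Localization.AtPrime P)` synthesis FAIL (a metavariable `v i : ?` is still pending inside the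
  type of `P` when the instance is needed; folder `T8/T9*.lean`, trace in `T9e.out`); typing the binder
  `fun v : Fin M → ℤ => …` or passing `dec` explicitly cures it (`T10.lean`).
* (F11) THE REGISTERED LINE `split` (targets-in-waiting; payload `targets` empty this cycle): the three
  stub statements were read symbol by symbol — they are FAITHFUL (details in the section docstring below:
  the chart rings ARE the coordinate rings of `X̄ ∩ D₊(X_{i+1})` computed inside `A_g[1/fᵢ] ⊆ k(U)`; the snc
  clause is Stacks 0BI9's local form; degenerate generator lists — `fᵢ = 0`, `fᵢ ∈ k^*`, `n = 0` — are
  handled consistently, the first by the zero ring: `stub_chart_subsingleton_of_eq_zero`,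
  `stub_chart_no_prime_of_eq_zero` below), `stub_sncClosureSchon` is KNOWN characteristic-free mathematics
  (Luxton–Qu Prop. 3.1 and the proof of Thm. 1.4, p. 7–8: the only char-0 input of their §3 is the snc
  compactification in its first sentence; `L + D_i` very ample and `#E_i ≥ dim|L + D_i| + dim Y + 1`
  generic sections, Bertini for hyperplane sections of the smooth strata, "complement of `dim|L|+1`
  sections in linear general position is very affine" — all char-free), and the two open stubs are
  CONSEQUENCES of the crux (closure of a schön `U[G⁻¹]` in a smooth projective toric variety of a fan
  supported on `Trop`, Tevelev 2007 Thm. 1.4 via KKMS toroidal theory, char-free; its boundary is snc and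
  supports an ample toric divisor, so `U[G⁻¹] = U_{∏G_j}` is the complement of a hyperplane section):
  the split neither loses nor gains strength relative to the crux.  No stub is refutable short of refuting
  weak (embedded) resolution in char `p`; no stub kill this cycle.
* (F12) WHY IT RESISTS (for the provers and the lead): every cheap attack lands on one of three walls —
  (W1) `∃ (m, G)` over `k̄[ℤ^N]` with `∀ w ∈ ℤ^(N+m)`: no finite search can certify `¬∃`; (W2) the only
  junk inhabitants are excluded by exactly the two guards of F8, and dropping `IsAlgClosed`/`CharP` only
  strengthens; (W3) the first dimension where a counterexample could live is `d = 2` (F5; d ≤ 1 true on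
  paper), where SchonAt follows from resolution of surfaces + embedded resolution of curves in surfaces +
  Goodman point blow-ups (regularity-preserving) + stub 3 — all known; `d = 3` likewise from
  CossartPiltant2019 + CJS2009/Cutkosky2009 Thm 1.2 (F2); so a counterexample needs `d ≥ 4` and would be a
  variety over `𝔽̄_p`-like fields with NO log-smooth projective compactification of any principal open —
  i.e. a failure of (weak, shrinking-allowed) resolution in dimension ≥ 4.  Attacks NOT run: the planner's
  Gröbner-fan toy on `z^p = F` surfaces (it probes the abandoned ENGINE, not the typed crux or the split;
  deferred unless the engine is re-attached as a line).
-/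

/-! ## (F8) Junk guards — what is (not) load-bearing in the typing (kernel-checked)
Landed verbatim as `Theorems/InductiveStep/Negative/InductiveStepWithoutIsPrimeIff.lean`; reproduced so
that this workfile stays self-contained (namespace differs). -/

section JunkGuards

open scoped Classical

/-- `in_w(1) = 1` for the route's inlined initial form (any weight): the constant `1 = x^0` is a single
term. [folklore] -/
theorem inductiveStep_inForm_one {k : Type} [Field k] {M : ℕ} (w : Fin M → ℤ)
    (dec : ∀ f : AddMonoidAlgebra k (Fin M → ℤ),
      DecidablePred fun v : Fin M → ℤ => ∀ u ∈ f.coeff.support, ∑ i, w i * v i ≤ ∑ i, w i * u i) :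
    (fun f : AddMonoidAlgebra k (Fin M → ℤ) => AddMonoidAlgebra.ofCoeff (@Finsupp.filter (Fin M → ℤ) k _ (fun v => ∀ u ∈ f.coeff.support, ∑ i, w i * v i ≤ ∑ i, w i * u i) (dec f) f.coeff)) 1 = 1 := by
  have h1 : (1 : AddMonoidAlgebra k (Fin M → ℤ)).coeff = Finsupp.single 0 1 := rfl
  beta_reduce
  have hf : ∀ x, (1 : AddMonoidAlgebra k (Fin M → ℤ)).coeff x ≠ 0 →
      ∀ u ∈ (1 : AddMonoidAlgebra k (Fin M → ℤ)).coeff.support, ∑ i, w i * x i ≤ ∑ i, w i * u i := by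
    intro x hx u hu
    rw [h1, Finsupp.mem_support_iff] at hu
    rw [h1] at hx
    rw [(Finsupp.single_apply_ne_zero.1 hx).1, (Finsupp.single_apply_ne_zero.1 hu).1]
  rw [(Finsupp.filter_eq_self_iff _ _).mpr hf]

/-- **No prime survives a unit extended ideal.** If `Ideal.span S = ⊤` in `k[ℤ^M]` then, for every
weight `w`, the initial ideal `in_w(Ideal.span S)` (the route's inlined term) contains `in_w(1) = 1`, so
the degeneration `k[ℤ^M] ⧸ in_w` is the zero ring and has no prime ideal. [folklore] -/
theorem inductiveStep_no_prime_of_span_eq_top {k : Type} [Field k] {M : ℕ}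
    (S : Set (AddMonoidAlgebra k (Fin M → ℤ))) (hS : Ideal.span S = ⊤) (w : Fin M → ℤ)
    (dec : ∀ f : AddMonoidAlgebra k (Fin M → ℤ),
      DecidablePred fun v : Fin M → ℤ => ∀ u ∈ f.coeff.support, ∑ i, w i * v i ≤ ∑ i, w i * u i)
    (P : Ideal (AddMonoidAlgebra k (Fin M → ℤ) ⧸ Ideal.span ((fun f : AddMonoidAlgebra k (Fin M → ℤ) => AddMonoidAlgebra.ofCoeff (@Finsupp.filter (Fin M → ℤ) k _ (fun v => ∀ u ∈ f.coeff.support, ∑ i, w i * v i ≤ ∑ i, w i * u i) (dec f) f.coeff)) '' (↑(Ideal.span S) : Set (AddMonoidAlgebra k (Fin M → ℤ))))))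
    [hP : P.IsPrime] : False := by
  have h1 : (1 : AddMonoidAlgebra k (Fin M → ℤ)) ∈ (↑(Ideal.span S) : Set (AddMonoidAlgebra k (Fin M → ℤ))) := by
    simp [hS]
  have hJ : Ideal.span ((fun f : AddMonoidAlgebra k (Fin M → ℤ) => AddMonoidAlgebra.ofCoeff (@Finsupp.filter (Fin M → ℤ) k _ (fun v => ∀ u ∈ f.coeff.support, ∑ i, w i * v i ≤ ∑ i, w i * u i) (dec f) f.coeff)) '' (↑(Ideal.span S) : Set (AddMonoidAlgebra k (Fin M → ℤ)))) = ⊤ :=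
    Ideal.eq_top_of_isUnit_mem _ (Ideal.subset_span ⟨1, h1, inductiveStep_inForm_one w dec⟩) isUnit_one
  haveI := Ideal.Quotient.subsingleton_iff.mpr hJ
  exact hP.ne_top (Subsingleton.elim _ _)

section ExtIdeal

variable {k : Type} [Field k] {N m : ℕ}

/-- The Laurent monomial `y_j` of the route is a unit of `k[ℤ^(N+m)]`. [folklore] -/
theorem inductiveStep_isUnit_yvar (j : Fin m) :
    IsUnit (AddMonoidAlgebra.single (Fin.append (0 : Fin N → ℤ) (Pi.single j (1 : ℤ))) (1 : k) :
      AddMonoidAlgebra k (Fin (N + m) → ℤ)) :=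
  Literature.AlgebraicGeometry.Tropical.isUnit_single isUnit_one _

/-- **A `G_j ∈ I` collapses the extended ideal**: then `y_j − ι G_j ∈ I'` and `ι G_j ∈ I'`, so the
unit `y_j` lies in `I' = ⟨ι I, y − ι G⟩`, i.e. `I' = ⊤`. [folklore] -/
theorem inductiveStep_extIdeal_eq_top_of_mem (I : Ideal (AddMonoidAlgebra k (Fin N → ℤ)))
    (G : Fin m → AddMonoidAlgebra k (Fin N → ℤ)) (j : Fin m) (hj : G j ∈ I) :
    Ideal.span ((fun f : AddMonoidAlgebra k (Fin N → ℤ) => (AddMonoidAlgebra.ofCoeff (f.coeff.mapDomain fun v => Fin.append v (0 : Fin m → ℤ)) : AddMonoidAlgebra k (Fin (N + m) → ℤ))) '' (↑I : Set (AddMonoidAlgebra k (Fin N → ℤ))) ∪ Set.range (fun j : Fin m => AddMonoidAlgebra.single (Fin.append (0 : Fin N → ℤ) (Pi.single j (1 : ℤ))) (1 : k) - AddMonoidAlgebra.ofCoeff ((G j).coeff.mapDomain fun v => Fin.append v (0 : Fin m → ℤ)))) = ⊤ := by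
  apply Ideal.eq_top_of_isUnit_mem _ ?_ (inductiveStep_isUnit_yvar (k := k) (N := N) j)
  have h1 : ((fun f : AddMonoidAlgebra k (Fin N → ℤ) => (AddMonoidAlgebra.ofCoeff (f.coeff.mapDomain fun v => Fin.append v (0 : Fin m → ℤ)) : AddMonoidAlgebra k (Fin (N + m) → ℤ))) (G j)) ∈ Ideal.span ((fun f : AddMonoidAlgebra k (Fin N → ℤ) => (AddMonoidAlgebra.ofCoeff (f.coeff.mapDomain fun v => Fin.append v (0 : Fin m → ℤ)) : AddMonoidAlgebra k (Fin (N + m) → ℤ))) '' (↑I : Set (AddMonoidAlgebra k (Fin N → ℤ))) ∪ Set.range (fun j : Fin m => AddMonoidAlgebra.single (Fin.append (0 : Fin N → ℤ) (Pi.single j (1 : ℤ))) (1 : k) - AddMonoidAlgebra.ofCoeff ((G j).coeff.mapDomain fun v => Fin.append v (0 : Fin m → ℤ)))) :=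
    Ideal.subset_span (Or.inl ⟨G j, hj, rfl⟩)
  have h2 := Ideal.subset_span (s := (fun f : AddMonoidAlgebra k (Fin N → ℤ) => (AddMonoidAlgebra.ofCoeff (f.coeff.mapDomain fun v => Fin.append v (0 : Fin m → ℤ)) : AddMonoidAlgebra k (Fin (N + m) → ℤ))) '' (↑I : Set (AddMonoidAlgebra k (Fin N → ℤ))) ∪ Set.range (fun j : Fin m => AddMonoidAlgebra.single (Fin.append (0 : Fin N → ℤ) (Pi.single j (1 : ℤ))) (1 : k) - AddMonoidAlgebra.ofCoeff ((G j).coeff.mapDomain fun v => Fin.append v (0 : Fin m → ℤ)))) (Or.inr ⟨j, rfl⟩)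
  simpa using Ideal.add_mem _ h2 h1

end ExtIdeal

/-- **Without the guard `∀ j, G j ∉ I` the conclusion of `SchonAt` is vacuous-true for EVERY ideal**
(any `k`, `N`, `I`; witness `m = 1`, `G = 0 ∈ I`): the displayed statement is the `∃ (m, G)`-clause of
the crux with the guard deleted. [folklore] -/
theorem inductiveStep_clause_without_notMem_guard {k : Type} [Field k] (N : ℕ)
    (I : Ideal (AddMonoidAlgebra k (Fin N → ℤ))) :
    ∃ (m : ℕ) (G : Fin m → AddMonoidAlgebra k (Fin N → ℤ)), ∀ (w : Fin (N + m) → ℤ) (P : Ideal (AddMonoidAlgebra k (Fin (N + m) → ℤ) ⧸ Ideal.span ((fun f : AddMonoidAlgebra k (Fin (N + m) → ℤ) => AddMonoidAlgebra.ofCoeff (f.coeff.filter fun v => ∀ u ∈ f.coeff.support, ∑ i, w i * v i ≤ ∑ i, w i * u i)) '' (↑(Ideal.span ((fun f : AddMonoidAlgebra k (Fin N → ℤ) => (AddMonoidAlgebra.ofCoeff (f.coeff.mapDomain fun v => Fin.append v (0 : Fin m → ℤ)) : AddMonoidAlgebra k (Fin (N + m) → ℤ))) '' (↑I : Set (AddMonoidAlgebra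 k (Fin N → ℤ))) ∪ Set.range (fun j : Fin m => AddMonoidAlgebra.single (Fin.append (0 : Fin N → ℤ) (Pi.single j (1 : ℤ))) (1 : k) - AddMonoidAlgebra.ofCoeff ((G j).coeff.mapDomain fun v => Fin.append v (0 : Fin m → ℤ))))) : Set (AddMonoidAlgebra k (Fin (N + m) → ℤ)))))) [P.IsPrime], IsRegularLocalRing (Localization.AtPrime P) := by
  refine ⟨1, fun _ => 0, ?_⟩
  intro w P hP
  exact (inductiveStep_no_prime_of_span_eq_top _
    (inductiveStep_extIdeal_eq_top_of_mem I (fun _ : Fin 1 => 0) 0 I.zero_mem) w _ P).elim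

section MulMem

variable {k : Type} [Field k] {N : ℕ}

/-- The lattice embedding `ℤ^N → ℤ^(N+m)`, `v ↦ (v, 0)`, is additive. [folklore] -/
theorem inductiveStep_append_zero_add (m : ℕ) (u v : Fin N → ℤ) :
    Fin.append (u + v) (0 : Fin m → ℤ) = Fin.append u 0 + Fin.append v 0 := by
  funext i
  refine Fin.addCases (fun i => ?_) (fun i => ?_) i <;> simp

/-- The route's `ι = k[v ↦ (v, 0)] : k[ℤ^N] → k[ℤ^(N+2)]` is multiplicative (it is
`AddMonoidAlgebra.mapDomain` of an additive map). [folklore] -/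
theorem inductiveStep_iota_mul (a b : AddMonoidAlgebra k (Fin N → ℤ)) :
    (fun f : AddMonoidAlgebra k (Fin N → ℤ) => (AddMonoidAlgebra.ofCoeff (f.coeff.mapDomain fun v => Fin.append v (0 : Fin 2 → ℤ)) : AddMonoidAlgebra k (Fin (N + 2) → ℤ))) (a * b) = (fun f : AddMonoidAlgebra k (Fin N → ℤ) => (AddMonoidAlgebra.ofCoeff (f.coeff.mapDomain fun v => Fin.append v (0 : Fin 2 → ℤ)) : AddMonoidAlgebra k (Fin (N + 2) → ℤ))) a * (fun f : AddMonoidAlgebra k (Fin N → ℤ) => (AddMonoidAlgebra.ofCoeff (f.coeff.mapDomain fun v => Fin.append v (0 : Fin 2 → ℤ)) : AddMonoidAlgebra k (Fin (N + 2) → ℤ))) b :=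
  AddMonoidAlgebra.mapDomain_mul
    ({ toFun := fun v => Fin.append v 0
       map_zero' := by simpa using inductiveStep_append_zero_add (N := N) 2 0 0
       map_add' := inductiveStep_append_zero_add 2 } : (Fin N → ℤ) →+ (Fin (N + 2) → ℤ)) a b

set_option maxHeartbeats 800000 in
/-- **A zero-divisor pair modulo `I` defeats the guard**: if `ab ∈ I`, the pair `G = (a, b)` gives
`I' = ⟨ι I, y₀ − ι a, y₁ − ι b⟩ = ⊤`, because `y₀ y₁ = (y₀ − ι a) y₁ + ι a (y₁ − ι b) + ι(ab) ∈ I'` is a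
unit; when `a ∉ I`, `b ∉ I` the pair passes the guard `∀ j, G j ∉ I`. (Displayed: the route's extended
ideal at `m = 2`, `G = ![a, b]`.) [folklore] -/
theorem inductiveStep_extIdeal_eq_top_of_mul_mem (I : Ideal (AddMonoidAlgebra k (Fin N → ℤ)))
    (a b : AddMonoidAlgebra k (Fin N → ℤ)) (hab : a * b ∈ I) :
    Ideal.span ((fun f : AddMonoidAlgebra k (Fin N → ℤ) => (AddMonoidAlgebra.ofCoeff (f.coeff.mapDomain fun v => Fin.append v (0 : Fin 2 → ℤ)) : AddMonoidAlgebra k (Fin (N + 2) → ℤ))) '' (↑I : Set (AddMonoidAlgebra k (Fin N → ℤ))) ∪ Set.range (fun j : Fin 2 => AddMonoidAlgebra.single (Fin.append (0 : Fin N → ℤ) (Pi.single j (1 : ℤ))) (1 : k) - AddMonoidAlgebra.ofCoeff ((![a, b] j).coeff.mapDomain fun v => Fin.append v (0 : Fin 2 → ℤ)))) = ⊤ := by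
  have h1 : (fun f : AddMonoidAlgebra k (Fin N → ℤ) => (AddMonoidAlgebra.ofCoeff (f.coeff.mapDomain fun v => Fin.append v (0 : Fin 2 → ℤ)) : AddMonoidAlgebra k (Fin (N + 2) → ℤ))) (a * b) ∈ Ideal.span ((fun f : AddMonoidAlgebra k (Fin N → ℤ) => (AddMonoidAlgebra.ofCoeff (f.coeff.mapDomain fun v => Fin.append v (0 : Fin 2 → ℤ)) : AddMonoidAlgebra k (Fin (N + 2) → ℤ))) '' (↑I : Set (AddMonoidAlgebra k (Fin N → ℤ))) ∪ Set.range (fun j : Fin 2 => AddMonoidAlgebra.single (Fin.append (0 : Fin N → ℤ) (Pi.single j (1 : ℤ))) (1 : k) - AddMonoidAlgebra.ofCoeff ((![a, b] j).coeff.mapDomain fun v => Fin.append v (0 : Fin 2 → ℤ)))) := Ideal.subset_span (Or.inl ⟨a * b, hab, rfl⟩)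
  have h2 := Ideal.subset_span (s := (fun f : AddMonoidAlgebra k (Fin N → ℤ) => (AddMonoidAlgebra.ofCoeff (f.coeff.mapDomain fun v => Fin.append v (0 : Fin 2 → ℤ)) : AddMonoidAlgebra k (Fin (N + 2) → ℤ))) '' (↑I : Set (AddMonoidAlgebra k (Fin N → ℤ))) ∪ Set.range (fun j : Fin 2 => AddMonoidAlgebra.single (Fin.append (0 : Fin N → ℤ) (Pi.single j (1 : ℤ))) (1 : k) - AddMonoidAlgebra.ofCoeff ((![a, b] j).coeff.mapDomain fun v => Fin.append v (0 : Fin 2 → ℤ)))) (Or.inr ⟨(0 : Fin 2), rfl⟩)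
  have h3 := Ideal.subset_span (s := (fun f : AddMonoidAlgebra k (Fin N → ℤ) => (AddMonoidAlgebra.ofCoeff (f.coeff.mapDomain fun v => Fin.append v (0 : Fin 2 → ℤ)) : AddMonoidAlgebra k (Fin (N + 2) → ℤ))) '' (↑I : Set (AddMonoidAlgebra k (Fin N → ℤ))) ∪ Set.range (fun j : Fin 2 => AddMonoidAlgebra.single (Fin.append (0 : Fin N → ℤ) (Pi.single j (1 : ℤ))) (1 : k) - AddMonoidAlgebra.ofCoeff ((![a, b] j).coeff.mapDomain fun v => Fin.append v (0 : Fin 2 → ℤ)))) (Or.inr ⟨(1 : Fin 2), rfl⟩)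
  rw [inductiveStep_iota_mul] at h1
  have hu := (inductiveStep_isUnit_yvar (k := k) (N := N) (0 : Fin 2)).mul
    (inductiveStep_isUnit_yvar (k := k) (N := N) (1 : Fin 2))
  refine Ideal.eq_top_of_isUnit_mem _ ?_ hu
  have key := Ideal.add_mem _ (Ideal.add_mem _ (Ideal.mul_mem_right
    (AddMonoidAlgebra.single (Fin.append (0 : Fin N → ℤ) (Pi.single (1 : Fin 2) (1 : ℤ))) (1 : k)) _
    h2) (Ideal.mul_mem_left _ ((fun f : AddMonoidAlgebra k (Fin N → ℤ) => (AddMonoidAlgebra.ofCoeff (f.coeff.mapDomain fun v => Fin.append v (0 : Fin 2 → ℤ)) : AddMonoidAlgebra k (Fin (N + 2) → ℤ))) a) h3)) h1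
  convert key using 1
  simp only [Matrix.cons_val_zero, Matrix.cons_val_one]
  ring

end MulMem

/-- `SchonAt` WITHOUT the primality hypothesis implies `SchonAt` (weakening). [folklore] -/
theorem inductiveStep_schonAt_of_withoutIsPrime (p d : ℕ)
    (h : ∀ (k : Type) [Field k] [CharP k p] [IsAlgClosed k] (N : ℕ) (I : Ideal (AddMonoidAlgebra k (Fin N → ℤ))), ringKrullDim (AddMonoidAlgebra k (Fin N → ℤ) ⧸ I) = (d : WithBot ℕ∞) → ∃ (m : ℕ) (G : Fin m → AddMonoidAlgebra k (Fin N → ℤ)), (∀ j, G j ∉ I) ∧ ∀ (w : Fin (N + m) → ℤ) (P : Ideal (AddMonoidAlgebra k (Fin (N + m) → ℤ) ⧸ Ideal.span ((fun f : AddMonoidAlgebra k (Fin (N + m) → ℤ) => AddMonoidAlgebra.ofCoeff (f.coeff.filter fun v => ∀ u ∈ f.coeff.support, ∑ i, w i * v i ≤ ∑ i, w i * u i)) '' (↑(Ideal.span ((fun f : AddMonoidAlgebra k (Fin N → ℤ) => (AddMonoidAlgebra.ofCoeff (f.coeff.mapDomain fun v => Fin.append v (0 : Fin m → ℤ)) :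 AddMonoidAlgebra k (Fin (N + m) → ℤ))) '' (↑I : Set (AddMonoidAlgebra k (Fin N → ℤ))) ∪ Set.range (fun j : Fin m => AddMonoidAlgebra.single (Fin.append (0 : Fin N → ℤ) (Pi.single j (1 : ℤ))) (1 : k) - AddMonoidAlgebra.ofCoeff ((G j).coeff.mapDomain fun v => Fin.append v (0 : Fin m → ℤ))))) : Set (AddMonoidAlgebra k (Fin (N + m) → ℤ)))))) [P.IsPrime], IsRegularLocalRing (Localization.AtPrime P)) :
    ∀ (k : Type) [Field k] [CharP k p] [IsAlgClosed k] (N : ℕ) (I : Ideal (AddMonoidAlgebra k (Fin N → ℤ))), I.IsPrime → ringKrullDim (AddMonoidAlgebra k (Fin N → ℤ) ⧸ I) = (d : WithBot ℕ∞) → ∃ (m : ℕ) (G : Fin m → AddMonoidAlgebra k (Fin N → ℤ)), (∀ j, G j ∉ I) ∧ ∀ (w : Fin (N + m) → ℤ) (P : Ideal (AddMonoidAlgebra k (Fin (N + m) → ℤ) ⧸ Ideal.span ((fun f : AddMonoidAlgebra k (Fin (N + m) → ℤ) => AddMonoidAlgebra.ofCoeff (f.coeff.filter fun v => ∀ u ∈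 f.coeff.support, ∑ i, w i * v i ≤ ∑ i, w i * u i)) '' (↑(Ideal.span ((fun f : AddMonoidAlgebra k (Fin N → ℤ) => (AddMonoidAlgebra.ofCoeff (f.coeff.mapDomain fun v => Fin.append v (0 : Fin m → ℤ)) : AddMonoidAlgebra k (Fin (N + m) → ℤ))) '' (↑I : Set (AddMonoidAlgebra k (Fin N → ℤ))) ∪ Set.range (fun j : Fin m => AddMonoidAlgebra.single (Fin.append (0 : Fin N → ℤ) (Pi.single j (1 : ℤ))) (1 : k) - AddMonoidAlgebra.ofCoeff ((G j).coeff.mapDomain fun v => Fin.append v (0 : Fin m → ℤ))))) : Set (AddMonoidAlgebra k (Fin (N + m) → ℤ)))))) [P.IsPrime], IsRegularLocalRing (Localization.AtPrime P) := by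
  intro k _ _ _ N I _ hdim
  exact h k N I hdim

/-- `SchonAt` implies `SchonAt` WITHOUT the primality hypothesis: a non-prime `I` of dimension `d` is
junk-true (`I = ⊤` is excluded by `ringKrullDim (k[ℤ^N] ⧸ ⊤) = ⊥`; otherwise a zero-divisor pair is a
guard-passing witness, `inductiveStep_extIdeal_eq_top_of_mul_mem`). [folklore] -/
theorem inductiveStep_withoutIsPrime_of_schonAt (p d : ℕ)
    (h : ∀ (k : Type) [Field k] [CharP k p] [IsAlgClosed k] (N : ℕ) (I : Ideal (AddMonoidAlgebra k (Fin N → ℤ))), I.IsPrime → ringKrullDim (AddMonoidAlgebra k (Fin N → ℤ) ⧸ I) = (d : WithBot ℕ∞) → ∃ (m : ℕ) (G : Fin m → AddMonoidAlgebra k (Fin N → ℤ)), (∀ j, G j ∉ I) ∧ ∀ (w : Fin (N + m) → ℤ) (P : Ideal (AddMonoidAlgebra k (Fin (N + m) → ℤ) ⧸ Ideal.span ((fun f : AddMonoidAlgebra k (Fin (N + m) → ℤ) => AddMonoidAlgebra.ofCoeff (f.coeff.filter fun v => ∀ u ∈ f.coeff.support, ∑ i, w i * v i ≤ ∑ i,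 w i * u i)) '' (↑(Ideal.span ((fun f : AddMonoidAlgebra k (Fin N → ℤ) => (AddMonoidAlgebra.ofCoeff (f.coeff.mapDomain fun v => Fin.append v (0 : Fin m → ℤ)) : AddMonoidAlgebra k (Fin (N + m) → ℤ))) '' (↑I : Set (AddMonoidAlgebra k (Fin N → ℤ))) ∪ Set.range (fun j : Fin m => AddMonoidAlgebra.single (Fin.append (0 : Fin N → ℤ) (Pi.single j (1 : ℤ))) (1 : k) - AddMonoidAlgebra.ofCoeff ((G j).coeff.mapDomain fun v => Fin.append v (0 : Fin m → ℤ))))) : Set (AddMonoidAlgebra k (Fin (N + m) → ℤ)))))) [P.IsPrime], IsRegularLocalRing (Localization.AtPrime P)) :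
    ∀ (k : Type) [Field k] [CharP k p] [IsAlgClosed k] (N : ℕ) (I : Ideal (AddMonoidAlgebra k (Fin N → ℤ))), ringKrullDim (AddMonoidAlgebra k (Fin N → ℤ) ⧸ I) = (d : WithBot ℕ∞) → ∃ (m : ℕ) (G : Fin m → AddMonoidAlgebra k (Fin N → ℤ)), (∀ j, G j ∉ I) ∧ ∀ (w : Fin (N + m) → ℤ) (P : Ideal (AddMonoidAlgebra k (Fin (N + m) → ℤ) ⧸ Ideal.span ((fun f : AddMonoidAlgebra k (Fin (N + m) → ℤ) => AddMonoidAlgebra.ofCoeff (f.coeff.filter fun v => ∀ u ∈ f.coeff.support, ∑ i, w i * v i ≤ ∑ i, w i * u i)) '' (↑(Ideal.span ((fun f : AddMonoidAlgebra k (Fin N → ℤ) => (AddMonoidAlgebra.ofCoeff (f.coeff.mapDomain fun v => Fin.append v (0 : Fin m → ℤ)) : AddMonoidAlgebra k (Fin (N + m) → ℤ))) '' (↑I : Set (AddMonoidAlgebra k (Fin N → ℤ))) ∪ Set.range (fun j : Fin m => AddMonoidAlgebra.single (Fin.append (0 : Fin N → ℤ) (Pi.single j (1 : ℤ))) (1 :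 k) - AddMonoidAlgebra.ofCoeff ((G j).coeff.mapDomain fun v => Fin.append v (0 : Fin m → ℤ))))) : Set (AddMonoidAlgebra k (Fin (N + m) → ℤ)))))) [P.IsPrime], IsRegularLocalRing (Localization.AtPrime P) := by
  intro k _ _ _ N I hdim
  by_cases hI : I.IsPrime
  · exact h k N I hI hdim
  · rcases Ideal.not_isPrime_iff.1 hI with htop | ⟨a, ha, b, hb, hab⟩
    · exfalso
      subst htop
      haveI : Subsingleton (AddMonoidAlgebra k (Fin N → ℤ) ⧸ (⊤ : Ideal (AddMonoidAlgebra k (Fin N → ℤ)))) :=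
        Ideal.Quotient.subsingleton_iff.mpr rfl
      rw [ringKrullDim_eq_bot_of_subsingleton] at hdim
      exact WithBot.bot_ne_coe hdim
    · refine ⟨2, ![a, b], ?_, ?_⟩
      · intro j
        fin_cases j
        · exact ha
        · exact hb
      · intro w P hP
        exact (inductiveStep_no_prime_of_span_eq_top _
          (inductiveStep_extIdeal_eq_top_of_mul_mem I a b hab) w _ P).elim

/-- **`I.IsPrime` is not load-bearing for the truth value of the crux.** The displayed statement is
`TropicalLinks.InductiveStep` with the hypothesis `I.IsPrime →` DELETED at both of its occurrences
(induction hypothesis and conclusion), everything else verbatim; it is EQUIVALENT to the crux: for a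
non-prime `I ≠ ⊤` a zero-divisor pair `(a, b)` is a guard-passing junk witness
(`inductiveStep_extIdeal_eq_top_of_mul_mem`), and `I = ⊤` is excluded by the dimension hypothesis
(`ringKrullDim` of the zero ring is `⊥`). So no refutation can use a reducible or non-reduced `V(I)`,
and a prover loses nothing by assuming primality. [folklore] -/
theorem inductiveStep_iff_withoutIsPrime :
    InductiveStep ↔ (∀ p : ℕ, p.Prime → ∀ d : ℕ, (∀ d' < d, (fun (p d : ℕ) => ∀ (k : Type) [Field k] [CharP k p] [IsAlgClosed k] (N : ℕ) (I : Ideal (AddMonoidAlgebra k (Fin N → ℤ))), ringKrullDim (AddMonoidAlgebra k (Fin N → ℤ) ⧸ I) = (d : WithBot ℕ∞) → ∃ (m : ℕ) (G : Fin m → AddMonoidAlgebra k (Fin N → ℤ)), (∀ j, G j ∉ I) ∧ ∀ (w : Fin (N + m) → ℤ) (P : Ideal (AddMonoidAlgebra k (Fin (N + m) → ℤ) ⧸ Ideal.span ((fun f : AddMonoidAlgebra k (Fin (N + m) → ℤ) => AddMonoidAlgebra.ofCoeff (f.coeff.filter fun v => ∀ u ∈ f.coeff.support, ∑ i, w i *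 v i ≤ ∑ i, w i * u i)) '' (↑(Ideal.span ((fun f : AddMonoidAlgebra k (Fin N → ℤ) => (AddMonoidAlgebra.ofCoeff (f.coeff.mapDomain fun v => Fin.append v (0 : Fin m → ℤ)) : AddMonoidAlgebra k (Fin (N + m) → ℤ))) '' (↑I : Set (AddMonoidAlgebra k (Fin N → ℤ))) ∪ Set.range (fun j : Fin m => AddMonoidAlgebra.single (Fin.append (0 : Fin N → ℤ) (Pi.single j (1 : ℤ))) (1 : k) - AddMonoidAlgebra.ofCoeff ((G j).coeff.mapDomain fun v => Fin.append v (0 : Fin m → ℤ))))) : Set (AddMonoidAlgebra k (Fin (N + m) → ℤ)))))) [P.IsPrime], IsRegularLocalRing (Localization.AtPrime P)) p d') → (fun (p d : ℕ) => ∀ (k : Type) [Field k] [CharP k p] [IsAlgClosed k] (N : ℕ) (I : Ideal (AddMonoidAlgebra k (Fin N → ℤ))), ringKrullDim (AddMonoidAlgebra k (Fin N → ℤ) ⧸ I) = (d : WithBot ℕ∞) → ∃ (m : ℕ) (G : Fin m → AddMonoidAlgebra k (Fin N → ℤ)), (∀ j, G j ∉ I) ∧ ∀ (w : Fin (N + m)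 → ℤ) (P : Ideal (AddMonoidAlgebra k (Fin (N + m) → ℤ) ⧸ Ideal.span ((fun f : AddMonoidAlgebra k (Fin (N + m) → ℤ) => AddMonoidAlgebra.ofCoeff (f.coeff.filter fun v => ∀ u ∈ f.coeff.support, ∑ i, w i * v i ≤ ∑ i, w i * u i)) '' (↑(Ideal.span ((fun f : AddMonoidAlgebra k (Fin N → ℤ) => (AddMonoidAlgebra.ofCoeff (f.coeff.mapDomain fun v => Fin.append v (0 : Fin m → ℤ)) : AddMonoidAlgebra k (Fin (N + m) → ℤ))) '' (↑I : Set (AddMonoidAlgebra k (Fin N → ℤ))) ∪ Set.range (fun j : Fin m => AddMonoidAlgebra.single (Fin.append (0 : Fin N → ℤ) (Pi.single j (1 : ℤ))) (1 : k) - AddMonoidAlgebra.ofCoeff ((G j).coeff.mapDomain fun v => Fin.append v (0 : Fin m → ℤ))))) : Set (AddMonoidAlgebra k (Fin (N + m) → ℤ)))))) [P.IsPrime], IsRegularLocalRing (Localization.AtPrime P)) p d) := by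
  constructor
  · intro h p hp d ih
    exact inductiveStep_withoutIsPrime_of_schonAt p d
      (h p hp d fun d' hd' => inductiveStep_schonAt_of_withoutIsPrime p d' (ih d' hd'))
  · intro h p hp d _
    exact inductiveStep_schonAt_of_withoutIsPrime p d
      (Nat.strong_induction_on d fun d ih => h p hp d ih)

end JunkGuards

/-! ## (F9) Shape of a counterexample; the crux through `IsSchonIdeal` (kernel-checked)
Landed verbatim as `Theorems/InductiveStep/Negative/NotInductiveStepIff.lean`. -/

section Shape

open scoped Classical

/-- **A refutation of the crux is exactly a refutation of the target.** `InductiveStep ↔ SchonPlus`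
(strong induction / weakening), contraposed. [folklore] -/
theorem not_inductiveStep_iff_not_schonPlus : ¬ InductiveStep ↔ ¬ SchonPlus := by
  refine not_congr ⟨fun h p hp d => ?_, fun h p hp d _ => h p hp d⟩
  induction d using Nat.strong_induction_on with
  | _ d ih => exact h p hp d ih

/-- **The exact shape of a counterexample to `InductiveStep`: a prime `p` and a MINIMAL failing
dimension** — `SchonAt p d` false with `SchonAt p d'` true for all `d' < d` (displayed: `SchonAt` is the
inlined λ of the route). [folklore] -/
theorem not_inductiveStep_iff_exists_minimal :
    ¬ InductiveStep ↔ ∃ p : ℕ, p.Prime ∧ ∃ d : ℕ, (∀ d' < d, (fun (p d : ℕ) => ∀ (k : Type) [Field k] [CharP k p] [IsAlgClosed k] (N : ℕ) (I : Ideal (AddMonoidAlgebra k (Fin N → ℤ))), I.IsPrime → ringKrullDim (AddMonoidAlgebra k (Fin N → ℤ) ⧸ I) = (d : WithBot ℕ∞) → ∃ (m : ℕ) (G : Fin m → AddMonoidAlgebra k (Fin N → ℤ)), (∀ j, G j ∉ I) ∧ ∀ (w : Fin (N + m) → ℤ) (P : Ideal (AddMonoidAlgebra k (Fin (N + m) →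 ℤ) ⧸ Ideal.span ((fun f : AddMonoidAlgebra k (Fin (N + m) → ℤ) => AddMonoidAlgebra.ofCoeff (f.coeff.filter fun v => ∀ u ∈ f.coeff.support, ∑ i, w i * v i ≤ ∑ i, w i * u i)) '' (↑(Ideal.span ((fun f : AddMonoidAlgebra k (Fin N → ℤ) => (AddMonoidAlgebra.ofCoeff (f.coeff.mapDomain fun v => Fin.append v (0 : Fin m → ℤ)) : AddMonoidAlgebra k (Fin (N + m) → ℤ))) '' (↑I : Set (AddMonoidAlgebra k (Fin N → ℤ))) ∪ Set.range (fun j : Fin m => AddMonoidAlgebra.single (Fin.append (0 : Fin N → ℤ) (Pi.single j (1 : ℤ))) (1 : k) - AddMonoidAlgebra.ofCoeff ((G j).coeff.mapDomain fun v => Fin.append v (0 : Fin m → ℤ))))) : Set (AddMonoidAlgebra k (Fin (N + m) → ℤ)))))) [P.IsPrime], IsRegularLocalRing (Localization.AtPrime P)) p d') ∧ ¬ (fun (p d : ℕ) => ∀ (k : Type) [Field k] [CharP k p] [IsAlgClosed k] (N : ℕ) (I : Ideal (AddMonoidAlgebra k (Fin N → ℤ))), I.IsPrime → ringKrullDim (AddMonoidAlgebra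 k (Fin N → ℤ) ⧸ I) = (d : WithBot ℕ∞) → ∃ (m : ℕ) (G : Fin m → AddMonoidAlgebra k (Fin N → ℤ)), (∀ j, G j ∉ I) ∧ ∀ (w : Fin (N + m) → ℤ) (P : Ideal (AddMonoidAlgebra k (Fin (N + m) → ℤ) ⧸ Ideal.span ((fun f : AddMonoidAlgebra k (Fin (N + m) → ℤ) => AddMonoidAlgebra.ofCoeff (f.coeff.filter fun v => ∀ u ∈ f.coeff.support, ∑ i, w i * v i ≤ ∑ i, w i * u i)) '' (↑(Ideal.span ((fun f : AddMonoidAlgebra k (Fin N → ℤ) => (AddMonoidAlgebra.ofCoeff (f.coeff.mapDomain fun v => Fin.append v (0 : Fin m → ℤ)) : AddMonoidAlgebra k (Fin (N + m) → ℤ))) '' (↑I : Set (AddMonoidAlgebra k (Fin N → ℤ))) ∪ Set.range (fun j : Fin m => AddMonoidAlgebra.single (Fin.append (0 : Fin N → ℤ) (Pi.single j (1 : ℤ))) (1 : k) - AddMonoidAlgebra.ofCoeff ((G j).coeff.mapDomain fun v => Fin.append v (0 : Fin m → ℤ))))) : Set (AddMonoidAlgebra k (Fin (N + m) → ℤ))))))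 [P.IsPrime], IsRegularLocalRing (Localization.AtPrime P)) p d := by
  unfold InductiveStep
  push Not
  rfl

/-- … and, forgetting minimality, a prime `p` and a dimension `d` with `¬ SchonAt p d`; by well-ordering
of `ℕ` the two shapes are equivalent. [folklore] -/
theorem not_inductiveStep_iff_exists :
    ¬ InductiveStep ↔ ∃ p : ℕ, p.Prime ∧ ∃ d : ℕ, ¬ (fun (p d : ℕ) => ∀ (k : Type) [Field k] [CharP k p] [IsAlgClosed k] (N : ℕ) (I : Ideal (AddMonoidAlgebra k (Fin N → ℤ))), I.IsPrime → ringKrullDim (AddMonoidAlgebra k (Fin N → ℤ) ⧸ I) = (d : WithBot ℕ∞) → ∃ (m : ℕ) (G : Fin m → AddMonoidAlgebra k (Fin N → ℤ)), (∀ j, G j ∉ I) ∧ ∀ (w : Fin (N + m) → ℤ) (P : Ideal (AddMonoidAlgebra k (Fin (N + m) → ℤ) ⧸ Ideal.span ((fun f : AddMonoidAlgebra k (Fin (N + m) → ℤ) => AddMonoidAlgebra.ofCoeff (f.coeff.filter fun v => ∀ u ∈ f.coeff.support, ∑ i, w i * v i ≤ ∑ i, w i * u i)) '' (↑(Ideal.span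 ((fun f : AddMonoidAlgebra k (Fin N → ℤ) => (AddMonoidAlgebra.ofCoeff (f.coeff.mapDomain fun v => Fin.append v (0 : Fin m → ℤ)) : AddMonoidAlgebra k (Fin (N + m) → ℤ))) '' (↑I : Set (AddMonoidAlgebra k (Fin N → ℤ))) ∪ Set.range (fun j : Fin m => AddMonoidAlgebra.single (Fin.append (0 : Fin N → ℤ) (Pi.single j (1 : ℤ))) (1 : k) - AddMonoidAlgebra.ofCoeff ((G j).coeff.mapDomain fun v => Fin.append v (0 : Fin m → ℤ))))) : Set (AddMonoidAlgebra k (Fin (N + m) → ℤ)))))) [P.IsPrime], IsRegularLocalRing (Localization.AtPrime P)) p d := by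
  rw [not_inductiveStep_iff_not_schonPlus]
  unfold SchonPlus
  push Not
  rfl

/-! ### The crux through the tree's named notion `IsSchonIdeal` -/

/-- **Bridge to the definition file**: the tree's `weightInitialIdeal w J` IS the route's inlined
initial ideal `Ideal.span (in_w '' J)` — for ANY decidability instance `dec` hidden in `Finsupp.filter`
(the route's term carries the classical one, the definition file's the constructive one; they are
propositionally, not definitionally, equal — closed by subsingleton elimination). [folklore] -/
theorem inductiveStep_weightInitialIdeal_eq_span {k : Type} [Field k] {M : ℕ} (w : Fin M → ℤ)
    (J : Ideal (AddMonoidAlgebra k (Fin M → ℤ)))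
    (dec : ∀ f : AddMonoidAlgebra k (Fin M → ℤ),
      DecidablePred fun v : Fin M → ℤ => ∀ u ∈ f.coeff.support, ∑ i, w i * v i ≤ ∑ i, w i * u i) :
    Literature.AlgebraicGeometry.Tropical.weightInitialIdeal w J =
      Ideal.span ((fun f : AddMonoidAlgebra k (Fin M → ℤ) => AddMonoidAlgebra.ofCoeff (@Finsupp.filter (Fin M → ℤ) k _ (fun v => ∀ u ∈ f.coeff.support, ∑ i, w i * v i ≤ ∑ i, w i * u i) (dec f) f.coeff)) '' (↑J : Set (AddMonoidAlgebra k (Fin M → ℤ)))) := by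
  unfold Literature.AlgebraicGeometry.Tropical.weightInitialIdeal
    Literature.AlgebraicGeometry.Tropical.initialIdeal Literature.AlgebraicGeometry.Tropical.initialForm
    Literature.AlgebraicGeometry.Tropical.dotWeight
  congr! 5

/-- Transport of the clause "all localizations of `R ⧸ J` at primes are regular" along an equality of
ideals. [folklore] -/
theorem inductiveStep_forall_prime_congr {k : Type} [Field k] {M : ℕ}
    {J₁ J₂ : Ideal (AddMonoidAlgebra k (Fin M → ℤ))} (h : J₁ = J₂) :
    (∀ (P : Ideal (AddMonoidAlgebra k (Fin M → ℤ) ⧸ J₁)) [P.IsPrime],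
        IsRegularLocalRing (Localization.AtPrime P)) ↔
      (∀ (P : Ideal (AddMonoidAlgebra k (Fin M → ℤ) ⧸ J₂)) [P.IsPrime],
        IsRegularLocalRing (Localization.AtPrime P)) := by
  subst h
  exact Iff.rfl

/-- **The route's schön clause is `IsSchonIdeal`**: for any ideal `J ⊆ k[ℤ^M]` (and any decidability
instances `dec`), `(∀ w P, IsRegularLocalRing (Localization.AtPrime P))` over the inlined degenerations
`k[ℤ^M] ⧸ in_w(J)` is `Literature.AlgebraicGeometry.Tropical.IsSchonIdeal J`. [folklore] -/
theorem inductiveStep_schonClause_iff_isSchonIdeal {k : Type} [Field k] {M : ℕ}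
    (J : Ideal (AddMonoidAlgebra k (Fin M → ℤ)))
    (dec : ∀ (w : Fin M → ℤ) (f : AddMonoidAlgebra k (Fin M → ℤ)),
      DecidablePred fun v : Fin M → ℤ => ∀ u ∈ f.coeff.support, ∑ i, w i * v i ≤ ∑ i, w i * u i) :
    (∀ (w : Fin M → ℤ) (P : Ideal (AddMonoidAlgebra k (Fin M → ℤ) ⧸
        Ideal.span ((fun f : AddMonoidAlgebra k (Fin M → ℤ) => AddMonoidAlgebra.ofCoeff (@Finsupp.filter (Fin M → ℤ) k _ (fun v => ∀ u ∈ f.coeff.support, ∑ i, w i * v i ≤ ∑ i, w i * u i) (dec w f) f.coeff)) '' (↑J : Set (AddMonoidAlgebra k (Fin M → ℤ)))))) [P.IsPrime],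
        IsRegularLocalRing (Localization.AtPrime P)) ↔
      Literature.AlgebraicGeometry.Tropical.IsSchonIdeal J :=
  forall_congr' fun w =>
    inductiveStep_forall_prime_congr (inductiveStep_weightInitialIdeal_eq_span w J (dec w)).symm

/-- `SchonAt p d` in `IsSchonIdeal` form implies the inlined `SchonAt p d`. [folklore] -/
theorem inductiveStep_schonAt_of_isSchonIdealForm (p d : ℕ)
    (h : ∀ (k : Type) [Field k] [CharP k p] [IsAlgClosed k] (N : ℕ) (I : Ideal (AddMonoidAlgebra k (Fin N → ℤ))), I.IsPrime → ringKrullDim (AddMonoidAlgebra k (Fin N → ℤ) ⧸ I) = (d : WithBot ℕ∞) → ∃ (m : ℕ) (G : Fin m → AddMonoidAlgebra k (Fin N → ℤ)), (∀ j, G j ∉ I) ∧ Literature.AlgebraicGeometry.Tropical.IsSchonIdeal (Ideal.span ((fun f : AddMonoidAlgebra k (Fin N → ℤ) => (AddMonoidAlgebra.ofCoeff (f.coeff.mapDomain fun v => Fin.append v (0 : Fin m → ℤ)) : AddMonoidAlgebra k (Fin (N + m) → ℤ))) '' (↑I : Set (AddMonoidAlgebra k (Fin N → ℤ))) ∪ Set.range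 (fun j : Fin m => AddMonoidAlgebra.single (Fin.append (0 : Fin N → ℤ) (Pi.single j (1 : ℤ))) (1 : k) - AddMonoidAlgebra.ofCoeff ((G j).coeff.mapDomain fun v => Fin.append v (0 : Fin m → ℤ)))))) :
    ∀ (k : Type) [Field k] [CharP k p] [IsAlgClosed k] (N : ℕ) (I : Ideal (AddMonoidAlgebra k (Fin N → ℤ))), I.IsPrime → ringKrullDim (AddMonoidAlgebra k (Fin N → ℤ) ⧸ I) = (d : WithBot ℕ∞) → ∃ (m : ℕ) (G : Fin m → AddMonoidAlgebra k (Fin N → ℤ)), (∀ j, G j ∉ I) ∧ ∀ (w : Fin (N + m) → ℤ) (P : Ideal (AddMonoidAlgebra k (Fin (N + m) → ℤ) ⧸ Ideal.span ((fun f : AddMonoidAlgebra k (Fin (N + m) → ℤ) => AddMonoidAlgebra.ofCoeff (f.coeff.filter fun v => ∀ u ∈ f.coeff.support, ∑ i, w i * v i ≤ ∑ i, w i * u i)) '' (↑(Ideal.span ((fun f : AddMonoidAlgebra k (Fin N → ℤ) => (AddMonoidAlgebra.ofCoeff (f.coeff.mapDomain fun v => Fin.append v (0 : Fin m → ℤ))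 : AddMonoidAlgebra k (Fin (N + m) → ℤ))) '' (↑I : Set (AddMonoidAlgebra k (Fin N → ℤ))) ∪ Set.range (fun j : Fin m => AddMonoidAlgebra.single (Fin.append (0 : Fin N → ℤ) (Pi.single j (1 : ℤ))) (1 : k) - AddMonoidAlgebra.ofCoeff ((G j).coeff.mapDomain fun v => Fin.append v (0 : Fin m → ℤ))))) : Set (AddMonoidAlgebra k (Fin (N + m) → ℤ)))))) [P.IsPrime], IsRegularLocalRing (Localization.AtPrime P) := by
  intro k _ _ _ N I hI hdim
  obtain ⟨m, G, hG, hS⟩ := h k N I hI hdim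
  exact ⟨m, G, hG, (inductiveStep_schonClause_iff_isSchonIdeal _ _).2 hS⟩

/-- The inlined `SchonAt p d` implies its `IsSchonIdeal` form. [folklore] -/
theorem inductiveStep_isSchonIdealForm_of_schonAt (p d : ℕ)
    (h : ∀ (k : Type) [Field k] [CharP k p] [IsAlgClosed k] (N : ℕ) (I : Ideal (AddMonoidAlgebra k (Fin N → ℤ))), I.IsPrime → ringKrullDim (AddMonoidAlgebra k (Fin N → ℤ) ⧸ I) = (d : WithBot ℕ∞) → ∃ (m : ℕ) (G : Fin m → AddMonoidAlgebra k (Fin N → ℤ)), (∀ j, G j ∉ I) ∧ ∀ (w : Fin (N + m) → ℤ) (P : Ideal (AddMonoidAlgebra k (Fin (N + m) → ℤ) ⧸ Ideal.span ((fun f : AddMonoidAlgebra k (Fin (N + m) → ℤ) => AddMonoidAlgebra.ofCoeff (f.coeff.filter fun v => ∀ u ∈ f.coeff.support, ∑ i, w i * v i ≤ ∑ i, w i * u i)) '' (↑(Ideal.span ((fun f : AddMonoidAlgebra k (Fin N → ℤ) => (AddMonoidAlgebra.ofCoeff (f.coeff.mapDomain fun v => Fin.append v (0 : Fin m → ℤ))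 : AddMonoidAlgebra k (Fin (N + m) → ℤ))) '' (↑I : Set (AddMonoidAlgebra k (Fin N → ℤ))) ∪ Set.range (fun j : Fin m => AddMonoidAlgebra.single (Fin.append (0 : Fin N → ℤ) (Pi.single j (1 : ℤ))) (1 : k) - AddMonoidAlgebra.ofCoeff ((G j).coeff.mapDomain fun v => Fin.append v (0 : Fin m → ℤ))))) : Set (AddMonoidAlgebra k (Fin (N + m) → ℤ)))))) [P.IsPrime], IsRegularLocalRing (Localization.AtPrime P)) :
    ∀ (k : Type) [Field k] [CharP k p] [IsAlgClosed k] (N : ℕ) (I : Ideal (AddMonoidAlgebra k (Fin N → ℤ))), I.IsPrime → ringKrullDim (AddMonoidAlgebra k (Fin N → ℤ) ⧸ I) = (d : WithBot ℕ∞) → ∃ (m : ℕ) (G : Fin m → AddMonoidAlgebra k (Fin N → ℤ)), (∀ j, G j ∉ I) ∧ Literature.AlgebraicGeometry.Tropical.IsSchonIdeal (Ideal.span ((fun f : AddMonoidAlgebra k (Fin N → ℤ) => (AddMonoidAlgebra.ofCoeff (f.coeff.mapDomain fun v => Fin.append v (0 : Fin m → ℤ)) : AddMonoidAlgebra k (Fin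 (N + m) → ℤ))) '' (↑I : Set (AddMonoidAlgebra k (Fin N → ℤ))) ∪ Set.range (fun j : Fin m => AddMonoidAlgebra.single (Fin.append (0 : Fin N → ℤ) (Pi.single j (1 : ℤ))) (1 : k) - AddMonoidAlgebra.ofCoeff ((G j).coeff.mapDomain fun v => Fin.append v (0 : Fin m → ℤ))))) := by
  intro k _ _ _ N I hI hdim
  obtain ⟨m, G, hG, hS⟩ := h k N I hI hdim
  exact ⟨m, G, hG, (inductiveStep_schonClause_iff_isSchonIdeal _ _).1 hS⟩

/-- **The crux restated through `IsSchonIdeal`** (same meaning, the schön clause named): `InductiveStep`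
is equivalent to `∀ p prime, ∀ d, (∀ d' < d, T p d') → T p d` with
`T p d := ∀ k N I, I prime, dim = d → ∃ m G, (∀ j, G j ∉ I) ∧ IsSchonIdeal ⟨ι I, y_j − ι G_j⟩`.
[folklore] -/
theorem inductiveStep_iff_isSchonIdeal_form :
    InductiveStep ↔ (∀ p : ℕ, p.Prime → ∀ d : ℕ, (∀ d' < d, (fun (p d : ℕ) => ∀ (k : Type) [Field k] [CharP k p] [IsAlgClosed k] (N : ℕ) (I : Ideal (AddMonoidAlgebra k (Fin N → ℤ))), I.IsPrime → ringKrullDim (AddMonoidAlgebra k (Fin N → ℤ) ⧸ I) = (d : WithBot ℕ∞) → ∃ (m : ℕ) (G : Fin m → AddMonoidAlgebra k (Fin N → ℤ)), (∀ j, G j ∉ I) ∧ Literature.AlgebraicGeometry.Tropical.IsSchonIdeal (Ideal.span ((fun f : AddMonoidAlgebra k (Fin N → ℤ) => (AddMonoidAlgebra.ofCoeff (f.coeff.mapDomain fun v => Fin.append v (0 : Fin m → ℤ)) : AddMonoidAlgebra k (Fin (N + m) → ℤ))) '' (↑I : Set (AddMonoidAlgebra k (Fin N → ℤ))) ∪ Set.range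 (fun j : Fin m => AddMonoidAlgebra.single (Fin.append (0 : Fin N → ℤ) (Pi.single j (1 : ℤ))) (1 : k) - AddMonoidAlgebra.ofCoeff ((G j).coeff.mapDomain fun v => Fin.append v (0 : Fin m → ℤ)))))) p d') → (fun (p d : ℕ) => ∀ (k : Type) [Field k] [CharP k p] [IsAlgClosed k] (N : ℕ) (I : Ideal (AddMonoidAlgebra k (Fin N → ℤ))), I.IsPrime → ringKrullDim (AddMonoidAlgebra k (Fin N → ℤ) ⧸ I) = (d : WithBot ℕ∞) → ∃ (m : ℕ) (G : Fin m → AddMonoidAlgebra k (Fin N → ℤ)), (∀ j, G j ∉ I) ∧ Literature.AlgebraicGeometry.Tropical.IsSchonIdeal (Ideal.span ((fun f : AddMonoidAlgebra k (Fin N → ℤ) => (AddMonoidAlgebra.ofCoeff (f.coeff.mapDomain fun v => Fin.append v (0 : Fin m → ℤ)) : AddMonoidAlgebra k (Fin (N + m) → ℤ))) '' (↑I : Set (AddMonoidAlgebra k (Fin N → ℤ))) ∪ Set.range (fun j : Fin m => AddMonoidAlgebra.single (Fin.append (0 : Fin N → ℤ) (Pi.single j (1 : ℤ))) (1 : k)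 - AddMonoidAlgebra.ofCoeff ((G j).coeff.mapDomain fun v => Fin.append v (0 : Fin m → ℤ)))))) p d) := by
  constructor
  · intro h p hp d ih
    exact inductiveStep_isSchonIdealForm_of_schonAt p d
      (h p hp d fun d' hd' => inductiveStep_schonAt_of_isSchonIdealForm p d' (ih d' hd'))
  · intro h p hp d ih
    exact inductiveStep_schonAt_of_isSchonIdealForm p d
      (h p hp d fun d' hd' => inductiveStep_isSchonIdealForm_of_schonAt p d' (ih d' hd'))

end Shape

/-! ## (F11) The registered line `split` — stub analysis (targets-in-waiting)

READING of the three stubs of `Lines/split.lean` (= the children of the prepared `route edit --split`):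

* Chart algebra is faithful.  For `A_g = Localization.Away (Ideal.Quotient.mk I g)` (`= (k[ℤ^N]⧸I)[g⁻¹]`,
  a nonzero DOMAIN as `I` is prime and `g ∉ I`) and generators `f : Fin n → A_g`
  (`Function.Surjective (MvPolynomial.aeval f)` = closed embedding `U_g ↪ 𝔸ⁿ = D₊(X₀) ⊆ ℙⁿ`), the ring
  `Bᵢ = k[X₀..X_n] ⧸ ker (X₀ ↦ 1/fᵢ, X_{j+1} ↦ fⱼ/fᵢ)` (map into `Localization.Away (f i) = A_g[1/fᵢ]`) is
  the `k`-subalgebra of `A_g[1/fᵢ] ⊆ k(U)` generated by `1/fᵢ, fⱼ/fᵢ`, which IS the coordinate ring of the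
  integral affine variety `X̄ ∩ D₊(X_{i+1})` (`X̄` = projective closure; `X₀/X_{i+1} = 1/fᵢ` and
  `X_{j+1}/X_{i+1} = fⱼ/fᵢ` as rational functions, and the coordinate ring of an integral affine variety is
  the image of the polynomial ring in its function field) — provided `fᵢ ≠ 0`; for `fᵢ = 0` the closure
  lies in `{X_{i+1} = 0}`, misses that chart, and indeed `Bᵢ = 0` (`stub_chart_subsingleton_of_eq_zero`):
  every chart hypothesis at `i` is then vacuous (`stub_chart_no_prime_of_eq_zero`), consistently.  For
  `fᵢ = c ∈ k^*`: `Bᵢ ≅ A_g` and the boundary equation `X₀ = 1/c` is a unit, snc clause vacuous — again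
  consistent (`X̄ ∩ D₊(X_{i+1}) = U_g`).  `n = 0` forces `A_g ≅ k` (a point; `d = 0`).  The generator
  `j = i` is `fᵢ/fᵢ = 1` (harmless).  Points at infinity (`X₀ = 0`) all lie in some `D₊(X_{i+1})`.
* The snc clause of stubs 2–3 (`∀ P ∋ t := class of X₀: ∃ r ≥ 1, e, x, y` with `span (x ∪ y) = 𝔪_P`,
  `dim = r + e`, `rad (t) = (∏ x_l)`) is Stacks 0BI9's local form: `𝒪_P` regular with a regular system of
  parameters in which `t = unit · ∏ x_l^{a_l}`, `a_l ≥ 1` (in the UFD `𝒪_P` the radical of a principal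
  ideal is generated by the product of the distinct prime factors, and parameters of an r.s.p. are pairwise
  non-associate primes).  Imposed at all primes `P ∋ t`, closed or not — equivalent to closed points only.
* Stub 3 (`stub_sncClosureSchon`) has a conclusion INDEPENDENT of `(g, n, f)`: it reads
  `∀ I prime, (∃ g n f, regular snc closure of U_g) → (∃ m G, G_j ∉ I ∧ all in_w⟨ι I, y − ι G⟩ regular)`.
  A kill would be a prime `I` with a log-smooth ample-boundary compactification of some `U_g` and NO schön
  principal-open re-embedding — a counterexample to Tevelev's conjecture for that `U`; not available.
  Its positive content is Luxton–Qu §3 run with `L = 𝒪(m·H_∞)` (so that the generic sections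
  `E ∈ |L + D_i|` restrict to REGULAR functions `φ = s_E/(s_{H_∞}^m s_{D_i})` on `U_g`, keeping `Y°`
  principal: `Y° = U_{g·∏φ}`), Prop. 3.1 (closed immersion `Y° → X(Δ)`, `S = Y ∩ O_{σ_S}` scheme-
  theoretically, structure map smooth and surjective), the dictionary "fibres of the structure map over
  `O_σ` ↔ `in_w(Y°)`, `w ∈ relint σ`" (Helm–Katz 2012), and the intrinsic-torus reduction by adjoining
  numerator lifts of a unit basis (F6).  All characteristic-free on pp. 7–8 as read; the phrase "Now assume
  char k = 0" (p. 7, l. 1 of §3) is used only for "It suffices to prove the theorem for a smooth variety"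
  + the snc compactification.
* Strength bookkeeping: crux (= X, Tevelev's conjecture, principal-open form) ⟹ stub 1 and stub 2
  (closure of the schön `U[G⁻¹]` in a smooth PROJECTIVE toric variety `X(Σ)`, `|Σ| ⊇ Trop`, is regular
  with snc boundary — Tevelev 2007 Thm 1.4 / 1.2, toroidal, char-free — and that boundary is the support of
  an ample effective toric divisor restricted to `X̄`, so `U[G⁻¹] = U_{∏ G_j}` is the complement of a
  hyperplane section in the embedding by a multiple: exactly the data `(g' = ∏ G_j, n', f')` of the stubs);
  stubs 1+2+3 ⟹ crux (`InductiveStep_of`, proved).  So the split is crux-equivalent modulo the known stub 3.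
-/

section Stubs

/-- For a generator list `f` with `f i = 0`, the `i`-th chart at infinity of the stubs
(`k[X₀..X_n] ⧸ ker (X₀ ↦ 1/fᵢ, X_{j+1} ↦ fⱼ/fᵢ)`, computed in `A[1/fᵢ] = A[1/0] = 0`) is the zero ring. -/
theorem stub_chart_subsingleton_of_eq_zero {k : Type} [Field k] {A : Type} [CommRing A] [Algebra k A]
    {n : ℕ} (f : Fin n → A) (i : Fin n) (hi : f i = 0) :
    Subsingleton (MvPolynomial (Fin (n + 1)) k ⧸ RingHom.ker (MvPolynomial.aeval
      (Fin.cons (IsLocalization.Away.invSelf (f i))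
        (fun j => algebraMap A (Localization.Away (f i)) (f j) * IsLocalization.Away.invSelf (f i)) :
        Fin (n + 1) → Localization.Away (f i)) :
      MvPolynomial (Fin (n + 1)) k →ₐ[k] Localization.Away (f i))) := by
  haveI : Subsingleton (Localization.Away (f i)) := by
    rw [hi]
    exact IsLocalization.subsingleton (M := Submonoid.powers (0 : A)) (Submonoid.mem_powers _)
  refine Ideal.Quotient.subsingleton_iff.mpr (eq_top_iff.mpr fun x _ => ?_)
  rw [RingHom.mem_ker]
  exact Subsingleton.elim _ _

/-- Hence every hypothesis of the stubs quantified over primes of that chart (chart regularity, the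
snc clause) is VACUOUS at such an index — consistently with the geometry (the projective closure of
`U_g ⊆ 𝔸ⁿ` does not meet the hyperplane-complement `{X_{i+1} ≠ 0}` when the coordinate `fᵢ` vanishes
on `U_g`). -/
theorem stub_chart_no_prime_of_eq_zero {k : Type} [Field k] {A : Type} [CommRing A] [Algebra k A]
    {n : ℕ} (f : Fin n → A) (i : Fin n) (hi : f i = 0)
    (P : Ideal (MvPolynomial (Fin (n + 1)) k ⧸ RingHom.ker (MvPolynomial.aeval
      (Fin.cons (IsLocalization.Away.invSelf (f i))
        (fun j => algebraMap A (Localization.Away (f i)) (f j) * IsLocalization.Away.invSelf (f i)) :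
        Fin (n + 1) → Localization.Away (f i)) :
      MvPolynomial (Fin (n + 1)) k →ₐ[k] Localization.Away (f i)))) : ¬ P.IsPrime := by
  haveI := stub_chart_subsingleton_of_eq_zero (k := k) f i hi
  exact fun hP => hP.ne_top (Subsingleton.elim _ _)

end Stubs

/-! # cdisprove gen 2, cycle 1 (refuter-cdisprove-stmt-ResolutionOfSingularities-17233-g2-0, 2026-08-17) — EXTENSION

Read at start: this file (F1–F12), the lead's NOTES.md / PICKED.md (line `split`, c1 + continuation:
verdict `promote-stub` for stubs 1–2, lead holds `stub_sncClosureSchon` and lays "Gröbner dictionary"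
bricks p159774 / p160399 / p160703 / p160862), `Lines/split.lean`, the two landed `Negative/` files, the
item's evidence.  Payload: `stuck_stubs = []`, `targets = []`.

STILL NO KILL of the crux (F1: ≡ SchonPlus ≡ Tevelev's schön-open conjecture in char `p`).  New content:

* (F13) **LEGS — a refuted natural strengthening, kernel-checked and LANDED**
  (`Theorems/InductiveStep/Negative/AboveGraphLegKernel.lean`, p162836 ACCEPTED;
  `…/Negative/AboveGraphNotVacuous.lean`, p163005).  The lead's reduction of the schön clause uses two
  vacuity bricks: BELOW the graph of `trop(G_j)` (`w''_j < ⟨w',u⟩ ∀ u ∈ supp G_j` ⇒ `in_w(I') = ⊤`,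
  p160703) and one-term initial forms (p160862).  The MIRROR IMAGE "ABOVE the graph
  (`w''_j > ⟨w',u⟩ ∀ u`) ⇒ `in_w(I') = ⊤`" is FALSE under every guard of the crux
  (`inductiveStep_not_aboveGraph_vacuity`): witness `p = 2`, `k = 𝔽̄₂`, `N = m = 1`, `I = ⊥` (`U = 𝔾_m`,
  prime, `d = 1`), `G₀ = x − 1 ∉ I`, `w = (0,1)`.  Mechanism: CANCELLATION — the valuation `ord_{x=1}` of
  `k(U)` has `val(x − 1) = 1 > 0 = min(val x, val 1)`, so `(0, 1) ∈ Trop(U[G⁻¹])` although it lies strictly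
  above the graph of `trop(x − 1) = min(w_x, 0)`; `Trop` of the graph embedding is the tropical
  MODIFICATION of `Trop U` along `trop(G|_U)` (a leg is attached over every point of `Trop U` where
  `in_{w'}(G)` vanishes somewhere on `in_{w'}(U)`), not the graph of `trop G`.  Kernel facts (route's
  inlined terms, any field `k`): `in_w(I') ≤ ker(x ↦ 1, z ↦ z)` (`inductiveStep_leg_inIdeal_le_ker`, by
  the `(X−1)`-adic order: every `f ∈ I'` dies under `x ↦ X, z ↦ X − 1`, hence its bottom `w`-layer — its
  initial form — has coefficient sum `0`); `in_w(I') ≠ ⊤` (`…_ne_top`); `x − 1 ∈ in_w(I')`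
  (`…_sub_mem_inIdeal`: initial form of the generator `z − x + 1`); `z − x + 1 ∉ in_w(I')`
  (`…_generator_notMem_inIdeal`), so `in_w(I') ≠ I'` and the displayed generators of `I'` are NOT a
  tropical basis at the leg — no recipe in `in_{w'}(I)`, `in_{w'}(G_j)`, `y_j` alone computes `in_w(I')`
  there.  On paper `in_w(I') = ⟨x − 1⟩`: the degeneration is the torus translate `{1} × 𝔾_m`, regular of
  dimension `1 = d` — the clause HOLDS at the leg, non-vacuously.
  MEANING FOR THE LINE: after p160703/p160862 the surviving weights are those where, for every `j`, the
  minimum of `{w''_j} ∪ {⟨w',u⟩ : u ∈ supp G_j}` is attained twice; this is the graph PLUS the legs over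
  `{in_{w'}(G_j) has ≥ 2 terms}`, and the legs carry content.  In Luxton–Qu §3 the legs are where the
  boundary strata `D_i ∩ E` (generic sections `E`) enter; in the route's abandoned ENGINE they are exactly
  the "link repair" locus — the place where the stated failure mode (non-terminating repair rounds) lives.
* (F14) **Stub mutation (line `split`, stubs 2–3): the conjunct `1 ≤ r` of the snc clause is AUTOMATIC**
  given its premise `mk X₀ ∈ P` (kernel-checked below: `split_sncClause_one_le_r_automatic` +
  `split_sncClause_nonunit`): for `r = 0` the empty product is `1`, `rad (t) = ⊤` forces `t` to be a unit,
  but `t ∈ P` is a non-unit of `Localization.AtPrime P`.  So a prover of `stub_sncBoundaryClosure` may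
  discharge `1 ≤ r` for free, and no refutation can come from `r = 0`.  The other conjuncts were re-read:
  `span (range x ∪ range y) = 𝔪` with `dim = r + e` forces `x, y` injective with disjoint ranges (a set of
  `< r + e` elements cannot generate an ideal of height `r + e` in a regular local ring), `rad (t) = (∏ x_l)`
  forces `t = unit · ∏ x_l^{a_l}`, `a_l ≥ 1` (UFD) — FAITHFUL (agreeing with the lead's clause audit).
* (F15) **Line `split` at gen 2 — no stub kill, no target.**  Joint sufficiency is kernel-checked
  (`InductiveStep_of`; it discards the induction hypothesis AND the dimension: the stubs are the
  all-dimensional statements).  Stub 1 (regular projective closure with hyperplane-complement boundary)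
  and stub 2 (snc boundary) are consequences of the crux (F11) and open in dim ≥ 4; their degenerate
  instances are TRUE (d = 0: `g = 1, n = 0`; d = 1: smooth completion minus points, any positive divisor on
  a curve is ample, points are snc — the lead's worker even finds d = 1 of stub 2 provable from the same
  datum); stub 3 is Luxton–Qu §3 + Tevelev 1.4 + Helm–Katz 3.9, characteristic-free.  Dropping stub-3
  hypotheses: without chart regularity + snc the hypothesis of stub 3 is satisfiable for EVERY prime `I`
  (some `U_g` is regular by generic smoothness over the perfect field `k`; `A_g` is finitely generated), so
  "stub 3 minus (regular closure, snc)" ≡ the crux itself — those hypotheses are exactly what separates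
  stub 3 from the open problem (costume check passed: stub 3 is NOT the crux in disguise BECAUSE of them).
* (F16) **Why it still resists** (update of F12): the only new attack surface found at gen 2 is the
  weight-region bookkeeping of the schön clause (F13), and there the clause turned out TRUE with content,
  not false.  A kill needs a `d ≥ 2` (realistically `d ≥ 4`, F12/W3) very affine variety over `𝔽̄_p` with no
  schön principal open; nothing in print (`ledger negatives`: none; `lit search` unavailable this session —
  searchd rc 75, to be retried).
-/

section Gen2

/-! ### (F14) the `1 ≤ r` conjunct of the snc clause is automatic -/

/-- In the snc clause of `stub_sncBoundaryClosure` / `stub_sncClosureSchon` the conjunct `1 ≤ r` is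
AUTOMATIC: if `t` is not a unit and `rad (t) = (∏_{l < r} x_l)` then `r ≠ 0` (for `r = 0` the empty
product is `1`). [folklore] -/
theorem split_sncClause_one_le_r_automatic {L : Type} [CommRing L] (t : L) (ht : ¬ IsUnit t)
    (r : ℕ) (x : Fin r → L) (hrad : (Ideal.span {t}).radical = Ideal.span {∏ l, x l}) : 1 ≤ r := by
  rcases Nat.eq_zero_or_pos r with rfl | hr
  · exfalso
    have h1 : (∏ l : Fin 0, x l) = 1 := Finset.prod_empty
    rw [h1, Ideal.span_singleton_one, Ideal.radical_eq_top, Ideal.span_singleton_eq_top] at hrad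
    exact ht hrad
  · exact hr

/-- … and the premise `t ∈ P` of the clause makes `t` a non-unit of `Localization.AtPrime P` (the ring in
which the clause is read). [folklore] -/
theorem split_sncClause_nonunit {B : Type} [CommRing B] (P : Ideal B) [P.IsPrime] (t : B) (ht : t ∈ P) :
    ¬ IsUnit (algebraMap B (Localization.AtPrime P) t) := fun hu =>
  (IsLocalization.AtPrime.isUnit_to_map_iff (Localization.AtPrime P) P t).1 hu ht

/-! ### (F13) the leg, re-derived from the landed kernel lemma (part 1, p162836)
The four consequences live in `Negative/AboveGraphNotVacuous.lean` (p163005); the shortest one is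
reproduced here so that this workfile exhibits the phenomenon by itself. -/

open AddMonoidAlgebra Literature.AlgebraicGeometry.Tropical in
open scoped Classical in
/-- `in_w(I') ≠ ⊤` at the leg weight `w = (0,1)` of `U = 𝔾_m`, `G₀ = x − 1` (route's inlined terms; any
field): the schön clause there is NOT vacuous although `w_z = 1 > 0 =` the weight of both monomials of
`G₀`.  From `Theorems.InductiveStep.Negative.inductiveStep_leg_inIdeal_le_ker` + `_exists_subst`. -/
theorem leg_inIdeal_ne_top (k : Type) [Field k] :
    Ideal.span ((fun f : AddMonoidAlgebra k (Fin (1 + 1) → ℤ) => AddMonoidAlgebra.ofCoeff (f.coeff.filter fun v => ∀ u ∈ f.coeff.support, ∑ i, (Fin.append (0 : Fin 1 → ℤ) (1 : Fin 1 → ℤ)) i * v i ≤ ∑ i, (Fin.append (0 : Fin 1 → ℤ) (1 : Fin 1 → ℤ)) i * u i)) '' (↑(Ideal.span ((fun f : AddMonoidAlgebra k (Fin 1 → ℤ) => (AddMonoidAlgebra.ofCoeff (f.coeff.mapDomain fun v => Fin.append v (0 : Fin 1 → ℤ)) : AddMonoidAlgebra k (Fin (1 + 1) → ℤ))) '' (↑(⊥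 : Ideal (AddMonoidAlgebra k (Fin 1 → ℤ))) : Set (AddMonoidAlgebra k (Fin 1 → ℤ))) ∪ Set.range (fun j : Fin 1 => AddMonoidAlgebra.single (Fin.append (0 : Fin 1 → ℤ) (Pi.single j (1 : ℤ))) (1 : k) - AddMonoidAlgebra.ofCoeff ((AddMonoidAlgebra.single (1 : Fin 1 → ℤ) (1 : k) - 1 : AddMonoidAlgebra k (Fin 1 → ℤ)).coeff.mapDomain fun v => Fin.append v (0 : Fin 1 → ℤ))))) : Set (AddMonoidAlgebra k (Fin (1 + 1) → ℤ)))) ≠ ⊤ := by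
  obtain ⟨Ψ, hΨ⟩ := Theorems.InductiveStep.Negative.inductiveStep_leg_exists_subst k
  have hle := Theorems.InductiveStep.Negative.inductiveStep_leg_inIdeal_le_ker k Ψ hΨ
  intro htop
  have h1 : (1 : AddMonoidAlgebra k (Fin (1 + 1) → ℤ)) ∈ RingHom.ker Ψ.toRingHom :=
    hle (htop.symm ▸ Submodule.mem_top)
  rw [RingHom.mem_ker] at h1
  exact one_ne_zero ((map_one Ψ.toRingHom).symm.trans h1)

end Gen2

/-! # cdisprove gen 2, cycle 1 — second half: the leg degeneration computed, and a NON-SCHÖN certificate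

* (F17) **LEG DEGENERATION OF A TORUS COMPLEMENT = `V(G₀) × 𝔾_m` (kernel, LANDED**
  `Negative/TorusLegDegeneration.lean`, p164079 ACCEPTED**)**: for ANY field `k`, ANY `N`, `I = ⊥`
  (`U = 𝔾_m^N`), ONE unit `G₀ ≠ 0` and the leg weight `w = (0,…,0,1)`:
  `in_w⟨ι(⊥), y − ι G₀⟩ = (ι G₀)` EXACTLY (`inductiveStep_torusLeg_inIdeal_eq_span`; `≤` by the `G₀`-adic
  order in `Frac k[ℤ^N]`, `≥` by the initial form `−ι G₀` of the generator).  So the schön clause at the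
  leg asks precisely that `V(G₀) ∩ 𝔾_m^N` be regular: removing a hypersurface re-embeds its LINK one
  dimension down as a leg degeneration.
* (F18) **NOT SCHÖN — a failing instance of the clause, and the refuted strengthening "any unit works"
  (kernel, LANDED `Negative/TorusLegNode.lean`, p164512)**: `N = 2`, `G₀ = (x₁ − 1)(x₂ − 1)` (the node,
  `G₀ ∉ ⊥`): `k[ℤ^(2+1)] ⧸ (ι G₀)` has a prime (the point `(1,1,1)`) whose localization is not a domain
  (`ι(x₁−1)·ι(x₂−1) = 0`, both factors nonzero there), hence not regular (Matsumura 14.3, in tree) —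
  `inductiveStep_torusLegNode_exists_not_regular`; therefore the route's INLINED schön clause
  `∀ w P, IsRegularLocalRing (Localization.AtPrime P)` FAILS for the datum `(k, N = 2, I = ⊥, m = 1, G₀)`
  for every field `k` (`inductiveStep_torusLegNode_schonClause_false`) — the first kernel-certified
  NON-schön re-embedding in the tree; and "for the torus (`I = ⊥`, prime, `d = N`, where `SchonAt` holds
  with `m = 0`) EVERY unit `G₀ ∉ I` gives a schön re-embedding" is REFUTED under all guards
  (`inductiveStep_not_schonClause_forall_units`, `p = 2`, `k = 𝔽̄₂`).
  MEANING: the `∃ (m, G)` of `SchonAt` is load-bearing in the strong sense — the units must be CHOSEN so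
  that their zero loci in `U` (and, via further legs, all initial degenerations of those) are regular,
  i.e. the new boundary must itself be schön in `U`'s torus; a schön `U` LOSES schön-ness by removing a
  singular divisor.  Steps (ii) "link repair" and (iii) "Bertini" of the crux's intended proof cannot be
  skipped, and a unit adjoined to repair one cone can spoil another (here the cone `0` of `Trop U`
  acquires a singular leg) — the formal shadow of the route's stated failure mode (non-terminating
  repair rounds).  For `stub_sncClosureSchon`: Luxton–Qu's GENERIC sections `E` are what keeps the legs
  (`D_i ∩ E` strata) regular; genericity is not cosmetic.
* (F19) **ELABORATION TRAP T3** (found while landing F18; will bite every prover instantiating the inlined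
  items at explicit units): instantiating an inlined-statement theorem (or the crux's clause) at a
  LITERAL unit family `G := fun _ => <explicit Laurent polynomial>` makes `whnf` time out (> 1.6 M
  heartbeats) as soon as the statement carries the quotient/localization types
  (`Ideal (k[ℤ^M] ⧸ Ideal.span …)`, `Localization.AtPrime P`); the statements themselves elaborate
  instantly.  REMEDY: `generalize hGf : (fun _ => G₀) = Gf at h ⊢` BEFORE instantiating (opaque family,
  no β-redexes inside dependent types), and transport `Gf 0 = G₀` by `rw` afterwards — see the proofs
  of `inductiveStep_torusLegNode_schonClause_false` / `inductiveStep_not_schonClause_forall_units`.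
* Census of landed negative knowledge for this crux (all `--supports` stmt-…-17233, std axioms):
  gen 1 — `InductiveStepWithoutIsPrimeIff` (p?), `NotInductiveStepIff`; gen 2 — `AboveGraphLegKernel`
  p162836, `AboveGraphNotVacuous` p163005, `TorusLegDegeneration` p164079, `TorusLegNode` p164512.
-/

section Gen2b

open AddMonoidAlgebra Literature.AlgebraicGeometry.Tropical

/-- (F17/F18 re-export) the NON-schön certificate, by name: the schön clause fails for the node.
See `Theorems.InductiveStep.Negative.inductiveStep_torusLegNode_schonClause_false`. -/
example (k : Type) [Field k] := Theorems.InductiveStep.Negative.inductiveStep_torusLegNode_schonClause_false k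

/-- (F18 re-export) the refuted strengthening "any unit works for the torus", by name. -/
example := Theorems.InductiveStep.Negative.inductiveStep_not_schonClause_forall_units

end Gen2b

end Summit.ResolutionOfSingularities.ResolutionOfSingularities.Cruxes.InductiveStep.Disproof
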